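import Literature.MathematicalPhysics.QuantumFieldTheory.Balaban1983to89.B9SupplySockB9P3ZdGammaUnivDelta2
import Literature.MathematicalPhysics.QuantumFieldTheory.Balaban1983to89.B8LeafModelZd3SockPer

/-!
# `Balaban1983to89.B8LeafModelZd3SockH2Per` — [Balaban1985RegularSpaces] (1.57)–(1.59) p. 86 ∕ [Balaban1985BackgroundPropagators] Thm 3.3, (3.40): THE PERIODIC-GUARDED
# **BOTH-POINTS** JUNCTION SOCKET `SockB9P3H2Per` — dag-n06-b's edition-δ₂ socket `B9SupplySockB9P3ZdGammaUnivDelta2.SockB9P3H2` (line 5's Hölder supremum over pairs with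
# BOTH points in `Ω_j`) VERBATIM with the three guards «`U₀`, `W`, `A′` are `P`-periodic» of dag-n06-b's `B8LeafModelZd3SockPer.SockB9P3Per` — the socket the (β′-PERIODIC)
# road reads under P4 ANSWER (ii) (member model `zdGF3HP₂Per`, δ₂ currency) and the one NODE N06's periodic objects can supply in that currency

statement-level skeleton of published theorems with citation tags; proofs where landed; nothing here is a claim about the Yang–Mills mass gap

`[Balaban1985RegularSpaces]` ("B8", CMP **99** (1985) 75–102): p. 77 (*«we admit the case when some domains Ω_j are equal to T_η»*), (1.38), (1.40)–(1.42) pp. 82–83,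
(1.57)–(1.59) p. 86 (*«A = G(U₀)J − … where the operator G(U₀) was introduced and investigated in [4]»*, the five lines of (1.59)), (1.39) p. 82 (the Hölder condition «on Ω_j»).
`[Balaban1985BackgroundPropagators]` ("[4]") Thm 3.3 pp. 398–399, (3.40) p. 397 (*«The norm |·|_β is the Hölder norm … on the ξ-lattice»* — the seminorm of a function ON THE DOMAIN:
both points of the pair in it), (3.42)–(3.43).  `[Balaban1985Averaging]` (4) p. 18 (the torus `T_η`).

CITATION HEADER ∕ WHY THIS FILE (cell `pub-ymgap`, HUMAN RULING D-0062; width seat `pub-ymgap-dag-n05-w1` (g4); CLAIM-4 on the cell bus 2026-08-28 14:58Z with first refusal to the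
socket-text owner dag-n06-b (g22 ■ CLOSE 15:00Z: «periodic-guarded editions of further binders ∕ sockets (δ₂ ∕ H2 road (ii)) — ON REQUEST»; no «mine» inside the window).  The (β′-PERIODIC)
road of NODE N05 under dag-n05-d's P4 ANSWER (ii) (plan g86 RATIFIED) runs on the P₂D member model read on periodic data (`B8LeafModelZdHP2Per.zdGF3HP₂Per`, dag-n05-c P1′),
whose Proposition-3 conjunct is typed in the δ₂ currency — the Hölder member of (1.36) and line 5 of (1.59) over pairs with BOTH points in `Ω_j` ([4] (3.40); print never weighs a pair
by the level of its first point alone) — i.e. against dag-n06-b's `SockB9P3H2`, UNGUARDED ([4] in infinite volume: all unitary `U₀`, `W`, all Hermitian `A′` on `ℤᵈ`).  NODE N06's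
objects on the (β′) road are the PERIODIC ones (`B9Eq327GreenZdHermPer.gopZdHPer`, the torus record `opsAllZdPer`, the supplier `B9SupplySockB9P3ZdPer.sockB9P3Per_opsAllZdPer_of_binders` of the
FIRST-POINT guarded socket `SockB9P3Per`); the δ₂ road needs the SAME guards on the BOTH-POINTS text.  THIS FILE is that text — ONE name for the consumer (this seat's
`B8Prop3PrintedZdGF3P2GammaOfSockPer`: Proposition 3 on `zdGF3P₂`'s periodic pairs ∕ on `zdGF3HP₂Per` ∕ at the records `famB8OfRecordSubBP₂DPer(κ)`) and for N06's future H2-periodic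
supplier (dag-n06-b's CLAIM-5 pattern with `HolderAtIPer` over the both-points class).

WHAT IS DECLARED ∕ PROVED (kernel, 0 sorry; ONE definition WITH BODY + two one-line theorems; no `instance`, no `notation`).
★ `SockB9P3H2Per P L B₀ B₀β cP β len η k Ω Λs Λb` — `SockB9P3H2`'s text with `IsPeriodic P U₀ → IsPeriodic P W →` inserted after the two unitarity clauses and `IsPeriodic P A' →`
after the Hermitian clause (`IsPeriodic` = `T4TermwiseTorus.IsPeriodic`, the tree's predicate of record; the SAME three guards at the SAME places as `SockB9P3Per`);
`sockB9P3H2Per_of_sockB9P3H2` (the unguarded socket implies the guarded one: drop the guards); `sockB9P3H2Per_anti` (antitone in the threshold `cP`).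

HONEST SCOPE: a socket TEXT (definition) + adapters; NOTHING of [B8] ∕ [4] proved; supplier (N06, periodic H2 Hölder entry) and consumer (this seat) are separate files; the located
member-currency species (H2 both-points vs print's first-point line, FLAG №4's narrow reading) is INSIDE the display either way and is not altered by a guard; count-neutral;
N05 ∕ N06 NOT discharged; K1⁹ NOT closed; one finite `𝕋⁴` programme at fixed `ε`, Bałaban AS PRINTED; the Yang–Mills mass gap (Clay) is NOT proved by any of this — R4 closes the
conditional finite-`𝕋⁴` rung `BalabanLadder.UV` only; nothing continuum ∕ ℝ⁴ ∕ OS.  Unit `pub-ymgap-dag-n05-w1` (g4), 2026-08-28.  No `sorry`, no `axiom`, no `instance`, no `notation`.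

RELATED, NOT DUPLICATED: `B9SupplySockB9P3ZdGammaUnivDelta2.SockB9P3H2` (the unguarded both-points text, dag-n06-b — REUSED for the adapter); `B8LeafModelZd3SockPer.SockB9P3Per`
(the guarded FIRST-POINT text, dag-n06-b — the pattern followed here; its per-direction readings `isPeriodic_of_forall_shift_e` ∕ `forall_shift_e_of_isPeriodic` serve this socket too);
`B8LeafModelZd3.SockB9P3` (dag-n05-a's original).

[cite: Balaban1985RegularSpaces, (1.57)–(1.59) p.86, (1.39) p.82, (1.40)–(1.42) p.83, p.77; Balaban1985BackgroundPropagators, Thm 3.3 p.398, (3.40) p.397; Balaban1985Averaging, (4) p.18]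
-/

noncomputable section

namespace Literature.MathematicalPhysics.QuantumFieldTheory.Balaban1983to89.B8LeafModelZd3SockH2Per

open B7Prop1Explicit B7Prop2Explicit
open B7Prop4GeneralLevels (linCovIter)
open B8Ineq132 (covDerivFwd InAk BondTouches)
open B8Eq184Proof (cfgExp)
open B8Lemma1NonAbelian (mulCfg)
open B8Eq140Level (SideTouches)
open B8Eq146AExpansion (iEta plaqCovDeriv)
open B8Eq143PlaqExpansion (pdiv)
open B8Eq155JBound (Jcur wsup)
open B8ScaledSupNorm (bondNorm msup)
open B8Eq138LandauZd (IsLandau138W covLap)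
open B9SupplySockB9P3ZdGammaUnivDelta2 (SockB9P3H2)
open B9Eq340HolderZd (hquot AdmPair)
open T4TermwiseTorus (IsPeriodic)

export B7Prop1Explicit (Site)

variable {d : ℕ} {𝔸 : Type*} [CStarAlgebra 𝔸]

/-- ★ **THE PERIODIC-GUARDED BOTH-POINTS IN-EDGE SOCKET OF PROPOSITION 3's FRAME** — dag-n06-b's `SockB9P3H2` (Theorem 3.3 of [4] for `G(U₀)` read through
(1.57)–(1.58): the FIVE lines of (1.59), line 5's weighted Hölder supremum over the admissible pairs with BOTH points in `Ω_j`) with the three data of the torus READ AS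
PERIODIC: for `P`-PERIODIC unitary `U₀`, `W` with (1.40) `U₀, WU₀ ∈ 𝔄_k({Ω_j}, α₀)`, the Landau condition of record (1.38)∕(1.42)₁ for `W`, and a `P`-PERIODIC Hermitian exponent
field `A′` with `W = e^{iηA′}`, (1.41) on the sides of the plaquettes touching `Ω_j` and `A′ = 0` off them: `|A′|₍₋₁₎, |∇^η_{U₀}A′|₍₋₂₎, |D^{η*}D^ηA′|₍₋₃₎, |Δ^η_{U₀}A′|₍₋₃₎ ≤
B₀(|J|₍₋₃₎ + |B₁|)` and the both-points Hölder line with `B₀(β)` — VERBATIM.  Guarded by `α₀, α₂ ≤ cP`.  On the torus `T_η = (ℤ∕P)ᵈ` of [B8] p. 77 every `U₀`, `W = U′`, `A′` of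
Prop. 3 is periodic on `ℤᵈ`, so this is the socket print uses in the δ₂ currency; it is what N06's periodic objects can supply per member.
[cite: Balaban1985RegularSpaces, (1.57)–(1.59) p.86, (1.39) p.82, (1.40)–(1.42) p.83, p.77 («we admit the case when some domains Ω_j are equal to T_η»); Balaban1985BackgroundPropagators, Thm 3.3 p.398, (3.40) p.397; Balaban1985Averaging, (4) p.18] -/
def SockB9P3H2Per (P : ℕ) (L : ℕ) (B₀ B₀β cP β : ℝ) (len : Site d → ℝ) (η : ℝ) (k : ℕ) (Ω : ℕ → Set (Site d))
    (Λs : ℕ → ℕ → Set (Site d)) (Λb : ℕ → ℕ → Set (Site d × Fin d)) : Prop :=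
  ∀ α₀ α₂ : ℝ, 0 < α₀ → α₀ ≤ cP → 0 < α₂ → α₂ ≤ cP →
    ∀ (U₀ W : Site d → Fin d → 𝔸ˣ), (∀ x κ, U₀ x κ ∈ unitaryUnits 𝔸) → (∀ x κ, W x κ ∈ unitaryUnits 𝔸) →
    IsPeriodic P U₀ → IsPeriodic P W →
    InAk L k η α₀ Ω U₀ → InAk L k η α₀ Ω (mulCfg W U₀) → IsLandau138W L k η (Ω 0) (Λs k) U₀ W →
    ∀ A' : Site d → Fin d → 𝔸, (∀ y τ, IsSelfAdjoint (A' y τ)) → IsPeriodic P A' →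
    (∀ j, j ≤ k → ∀ (y : Site d) (τ : Fin d), SideTouches (Ω j) y τ →
      W y τ = cfgExp η A' y τ ∧ ‖A' y τ‖ ≤ α₂ * ((L : ℝ) ^ j * η)⁻¹) →
    (∀ (y : Site d) (τ : Fin d), (∀ j, j ≤ k → ¬ SideTouches (Ω j) y τ) → A' y τ = 0) →
    msup L k η (-(1 : ℝ)) (fun j (b : Site d × Fin d) => SideTouches (Ω j) b.1 b.2) (fun b => A' b.1 b.2)
        ≤ B₀ * (bondNorm L k η (-(3 : ℝ)) Ω (fun x μ => Jcur η U₀ A' μ x)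
          + wsup 1 (fun p : {p : ℕ × (Site d × Fin d) // p.1 ≤ k ∧ p.2 ∈ Λb k p.1} =>
              linCovIter L U₀ (iEta η A') p.1.1 p.1.2.1 p.1.2.2)) ∧
      msup L k η (-(2 : ℝ)) (fun j (t : Fin d × Fin d × Site d) => SideTouches (Ω j) t.2.2 t.2.1)
          (fun t => covDerivFwd η U₀ t.1 (fun z => A' z t.2.1) t.2.2)
        ≤ B₀ * (bondNorm L k η (-(3 : ℝ)) Ω (fun x μ => Jcur η U₀ A' μ x)
          + wsup 1 (fun p : {p : ℕ × (Site d × Fin d) // p.1 ≤ k ∧ p.2 ∈ Λb k p.1} =>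
              linCovIter L U₀ (iEta η A') p.1.1 p.1.2.1 p.1.2.2)) ∧
      bondNorm L k η (-(3 : ℝ)) Ω (fun x μ => pdiv η U₀ (plaqCovDeriv η U₀ A') μ x)
        ≤ B₀ * (bondNorm L k η (-(3 : ℝ)) Ω (fun x μ => Jcur η U₀ A' μ x)
          + wsup 1 (fun p : {p : ℕ × (Site d × Fin d) // p.1 ≤ k ∧ p.2 ∈ Λb k p.1} =>
              linCovIter L U₀ (iEta η A') p.1.1 p.1.2.1 p.1.2.2)) ∧
      bondNorm L k η (-(3 : ℝ)) Ω (fun x μ => covLap η U₀ (fun z => A' z μ) x)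
        ≤ B₀ * (bondNorm L k η (-(3 : ℝ)) Ω (fun x μ => Jcur η U₀ A' μ x)
          + wsup 1 (fun p : {p : ℕ × (Site d × Fin d) // p.1 ≤ k ∧ p.2 ∈ Λb k p.1} =>
              linCovIter L U₀ (iEta η A') p.1.1 p.1.2.1 p.1.2.2)) ∧
      msup L k η (-(2 + β)) (fun j (q : Fin d × Fin d × (Site d × Site d)) => q.2.2 ∈ AdmPair η len ∧ q.2.2.1 ∈ Ω j ∧ q.2.2.2 ∈ Ω j)
          (fun q => hquot η β len U₀ (covDerivFwd η U₀ q.1 (fun z => A' z q.2.1)) q.2.2)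
        ≤ B₀β * (bondNorm L k η (-(3 : ℝ)) Ω (fun x μ => Jcur η U₀ A' μ x)
          + wsup 1 (fun p : {p : ℕ × (Site d × Fin d) // p.1 ≤ k ∧ p.2 ∈ Λb k p.1} =>
              linCovIter L U₀ (iEta η A') p.1.1 p.1.2.1 p.1.2.2))

/-- **THE UNGUARDED BOTH-POINTS SOCKET IMPLIES THE GUARDED ONE** (drop the three periodicity hypotheses). [cite: Balaban1985RegularSpaces, (1.59) p.86, p.77 («Ω_j = T_η»); Balaban1985BackgroundPropagators, (3.40) p.397] -/
theorem sockB9P3H2Per_of_sockB9P3H2 [Nontrivial 𝔸] (P : ℕ) {L : ℕ} {B₀ B₀β cP β : ℝ} {len : Site d → ℝ} {η : ℝ} {k : ℕ} {Ω : ℕ → Set (Site d)}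
    {Λs : ℕ → ℕ → Set (Site d)} {Λb : ℕ → ℕ → Set (Site d × Fin d)} (S : SockB9P3H2 (𝔸 := 𝔸) L B₀ B₀β cP β len η k Ω Λs Λb) :
    SockB9P3H2Per (𝔸 := 𝔸) P L B₀ B₀β cP β len η k Ω Λs Λb :=
  fun α₀ α₂ hα₀ hα₀c hα₂ hα₂c U₀ W hU₀ hW _ _ hInU hInW hLan A' hsa _ hexp hoff =>
    S α₀ α₂ hα₀ hα₀c hα₂ hα₂c U₀ W hU₀ hW hInU hInW hLan A' hsa hexp hoff

/-- `SockB9P3H2Per` is antitone in the threshold `cP`. [cite: Balaban1985RegularSpaces, (1.59) p.86 (bookkeeping)] -/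
theorem sockB9P3H2Per_anti {P L : ℕ} {B₀ B₀β cP cP' β : ℝ} {len : Site d → ℝ} (h : cP' ≤ cP) {η : ℝ} {k : ℕ} {Ω : ℕ → Set (Site d)}
    {Λs : ℕ → ℕ → Set (Site d)} {Λb : ℕ → ℕ → Set (Site d × Fin d)} (S : SockB9P3H2Per (𝔸 := 𝔸) P L B₀ B₀β cP β len η k Ω Λs Λb) :
    SockB9P3H2Per (𝔸 := 𝔸) P L B₀ B₀β cP' β len η k Ω Λs Λb :=
  fun α₀ α₂ hα₀ hα₀c hα₂ hα₂c => S α₀ α₂ hα₀ (hα₀c.trans h) hα₂ (hα₂c.trans h)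

/-- **THE GUARDED BOTH-POINTS SOCKET FED WITH GUARDS IN THE PER-DIRECTION FORM** `∀ z i, F (z + P•e_i) = F z` (cell `lit-balaban`'s displayed shape; dag-n06-b's
`B8LeafModelZd3SockPer.isPeriodic_of_forall_shift_e` BY NAME): the three `IsPeriodic` premisses from per-direction hypotheses. [cite: Balaban1985RegularSpaces, (1.59) p.86, p.77 («Ω_j = T_η»)] -/
theorem sockB9P3H2Per_guards_of_forall_shift_e {P : ℕ} {U₀ W : Site d → Fin d → 𝔸ˣ} {A' : Site d → Fin d → 𝔸}
    (hU₀p : ∀ (z : Site d) (i : Fin d), U₀ (z + (P : ℤ) • e i) = U₀ z) (hWp : ∀ (z : Site d) (i : Fin d), W (z + (P : ℤ) • e i) = W z)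
    (hA'p : ∀ (z : Site d) (i : Fin d), A' (z + (P : ℤ) • e i) = A' z) :
    IsPeriodic P U₀ ∧ IsPeriodic P W ∧ IsPeriodic P A' :=
  ⟨B8LeafModelZd3SockPer.isPeriodic_of_forall_shift_e hU₀p, B8LeafModelZd3SockPer.isPeriodic_of_forall_shift_e hWp,
    B8LeafModelZd3SockPer.isPeriodic_of_forall_shift_e hA'p⟩

end Literature.MathematicalPhysics.QuantumFieldTheory.Balaban1983to89.B8LeafModelZd3SockH2Per

end
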